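import Summits.AtomisticToContinuum.Crystallization.Theorems.TwoCentreKissingKernelRobustTangencyBoundAssembly
import HarnessLib

/-!
# `RobustTangencyBound` — the two halves of the effective 24-tangency programme, as parametrised
# predicates, and the reduction

Route `TwoCentreKissingKernel`, item `stmt-AtomisticToContinuum-12082` (`RobustTangencyBound`).
The item is the effective form of Flatley–Tarasov–Taylor–Theil's 24-tangency theorem; its proof
programme (recorded with the item) has a COMBINATORIAL half — the soft contact graph of a shell
with `≥ 24` soft contacts is the cuboctahedron or the anticuboctahedron graph, i.e. the shell admits
a labelling by `Fin 12` under which every FCC (resp. HCP) pattern contact is a soft contact — and a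
METRIC half — a labelled soft realisation of the FCC (resp. HCP) contact structure is `1/10`-close,
after a linear isometry, to the labelled pattern ("FT Prop. 3.3(2) made effective").  This file
names the two halves as route-internal PREDICATES, parametrised by the tolerance `η` and the
closeness `δ` (the tables `fccTab`, `hcpTab` of `KissingRigidity.lean`; contacts read off as
`sqNormInt (fccTab i − fccTab j) = 2`, resp. `= 18` for `hcpTab`), and PROVES the reduction
`robustTangencyBound_of_halves`: classification at every `η ∈ [0, 10⁻³]` and rigidity at
`(η, 1/10)` for both patterns imply `RobustTangencyBound` (pure bookkeeping through
`shellCloseTo_fcc/hcp_of_labelled`).  Nothing here closes the item; the two halves are what remains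
to be proved (both hold numerically at the item's constants — evidence on the item — the metric
half with a factor ≈ 1.7 to spare in displacement at `η = 10⁻³`).  The predicates carry parameters
(route-internal bookkeeping, not literature facts).

* `IsFccSoftLabelling η T x` / `IsHcpSoftLabelling η T x` — `x : Fin 12 → ℝ³` injectively
  enumerates `T` and every pattern contact `(i, j)` has `dist (x i) (x j) ≤ 1 + η`.
* `SoftShellClassificationAt η` — hypotheses of `RobustTangencyBound` at tolerance `η` ⇒ such a
  labelling exists (FCC or HCP).
* `EffectiveRigidityFccAt η δ` / `EffectiveRigidityHcpAt η δ` — a labelled configuration with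
  norms in `[1 − η, 1 + η]`, pairwise distances `≥ 1 − η` and the pattern contacts soft has
  `dist (x i) (A pᵢ) ≤ δ` for some linear isometry `A` (every graph automorphism of either pattern
  graph is induced by an isometry of the pattern — orders `48` and `12` — so the labelled form
  loses nothing).
* `robustTangencyBound_of_halves` — the reduction.
-/

noncomputable section

namespace Summit.AtomisticToContinuum.Crystallization.Theorems

open Literature.Geometry.DiscreteGeometry Finset
open Summit.AtomisticToContinuum.Crystallization.Theses.TwoCentreKissingKernel

/-- **A soft FCC labelling of the shell `T` at tolerance `η`**: an injective enumeration
`x : Fin 12 → ℝ³` of `T` under which every contact of the FCC pattern (pairs of `fccTab` at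
squared integer distance `2`, i.e. at distance `1` after scaling by `1/√2`) is a soft contact,
`dist (x i) (x j) ≤ 1 + η`. Route-internal predicate. [folklore] -/
def IsFccSoftLabelling (η : ℝ) (T : Finset (EuclideanSpace ℝ (Fin 3)))
    (x : Fin 12 → EuclideanSpace ℝ (Fin 3)) : Prop :=
  Function.Injective x ∧ T = Finset.univ.image x ∧
    ∀ i j : Fin 12, sqNormInt (fccTab i - fccTab j) = 2 → dist (x i) (x j) ≤ 1 + η

/-- **A soft HCP labelling of the shell `T` at tolerance `η`** (contacts of the HCP pattern:
pairs of `hcpTab` at squared integer distance `18`). Route-internal predicate. [folklore] -/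
def IsHcpSoftLabelling (η : ℝ) (T : Finset (EuclideanSpace ℝ (Fin 3)))
    (x : Fin 12 → EuclideanSpace ℝ (Fin 3)) : Prop :=
  Function.Injective x ∧ T = Finset.univ.image x ∧
    ∀ i j : Fin 12, sqNormInt (hcpTab i - hcpTab j) = 18 → dist (x i) (x j) ≤ 1 + η

/-- **The combinatorial half of `RobustTangencyBound` at tolerance `η` (effective FTTT
classification).** Under the hypotheses of the item — twelve points with norms in `[1 − η, 1 + η]`,
pairwise distances `≥ 1 − η`, at least `48` ordered soft-contact pairs — the shell admits a soft
FCC labelling or a soft HCP labelling: its soft contact graph contains (hence, having `24` edges,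
is) the cuboctahedron or the anticuboctahedron graph.  Route-internal statement (the target of
steps (II)–(IV) of the item's programme; not a literature fact). [folklore] -/
def SoftShellClassificationAt (η : ℝ) : Prop :=
  ∀ T : Finset (EuclideanSpace ℝ (Fin 3)), T.card = 12 →
    (∀ y ∈ T, 1 - η ≤ ‖y‖ ∧ ‖y‖ ≤ 1 + η) →
    (∀ y ∈ T, ∀ y' ∈ T, y ≠ y' → 1 - η ≤ dist y y') →
    48 ≤ Nat.card {q : ↥T × ↥T // q.1 ≠ q.2 ∧ dist (q.1 : EuclideanSpace ℝ (Fin 3)) q.2 ≤ 1 + η} →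
    ∃ x : Fin 12 → EuclideanSpace ℝ (Fin 3), IsFccSoftLabelling η T x ∨ IsHcpSoftLabelling η T x

/-- **The metric half for FCC (effective rigidity of the cuboctahedron contact framework).**
A labelled configuration `x : Fin 12 → ℝ³` with norms in `[1 − η, 1 + η]`, pairwise distances
`≥ 1 − η` and all FCC pattern contacts soft is within `δ`, pointwise and with the same labels, of
the image of the FCC pattern `fccTab i/√2` under some linear isometry.
Route-internal statement (step (V) of the item's programme; not a literature fact). [folklore] -/
def EffectiveRigidityFccAt (η δ : ℝ) : Prop :=
  ∀ x : Fin 12 → EuclideanSpace ℝ (Fin 3),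
    (∀ i, 1 - η ≤ ‖x i‖ ∧ ‖x i‖ ≤ 1 + η) → (∀ i j, i ≠ j → 1 - η ≤ dist (x i) (x j)) →
    (∀ i j : Fin 12, sqNormInt (fccTab i - fccTab j) = 2 → dist (x i) (x j) ≤ 1 + η) →
    ∃ A : EuclideanSpace ℝ (Fin 3) →ₗᵢ[ℝ] EuclideanSpace ℝ (Fin 3),
      ∀ i, dist (x i) (A ((Real.sqrt 2)⁻¹ • intVec (fccTab i))) ≤ δ

/-- **The metric half for HCP (effective rigidity of the anticuboctahedron contact framework).**
Route-internal statement (step (V); not a literature fact). [folklore] -/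
def EffectiveRigidityHcpAt (η δ : ℝ) : Prop :=
  ∀ x : Fin 12 → EuclideanSpace ℝ (Fin 3),
    (∀ i, 1 - η ≤ ‖x i‖ ∧ ‖x i‖ ≤ 1 + η) → (∀ i j, i ≠ j → 1 - η ≤ dist (x i) (x j)) →
    (∀ i j : Fin 12, sqNormInt (hcpTab i - hcpTab j) = 18 → dist (x i) (x j) ≤ 1 + η) →
    ∃ A : EuclideanSpace ℝ (Fin 3) →ₗᵢ[ℝ] EuclideanSpace ℝ (Fin 3),
      ∀ i, dist (x i) (A ((Real.sqrt 18)⁻¹ • intVec (hcpTab i))) ≤ δ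

/-- Points of an enumerated shell are members of it. -/
theorem mem_of_eq_image {T : Finset (EuclideanSpace ℝ (Fin 3))}
    {x : Fin 12 → EuclideanSpace ℝ (Fin 3)} (hT : T = Finset.univ.image x) (i : Fin 12) :
    x i ∈ T := by
  rw [hT]; exact Finset.mem_image_of_mem _ (Finset.mem_univ _)

/-- **The reduction.** Classification at every tolerance `η ∈ [0, 10⁻³]` and rigidity at
`(η, 1/10)` for both patterns imply `RobustTangencyBound`: label the shell, transfer the norm and
separation hypotheses to the labelling, apply the rigidity half, and conclude `ShellCloseTo` by
`shellCloseTo_fcc/hcp_of_labelled`. -/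
theorem robustTangencyBound_of_halves
    (hC : ∀ η : ℝ, 0 ≤ η → η ≤ 1 / 1000 → SoftShellClassificationAt η)
    (hF : ∀ η : ℝ, 0 ≤ η → η ≤ 1 / 1000 → EffectiveRigidityFccAt η (1 / 10))
    (hH : ∀ η : ℝ, 0 ≤ η → η ≤ 1 / 1000 → EffectiveRigidityHcpAt η (1 / 10)) :
    RobustTangencyBound := by
  intro η hη0 hη T hT hnorm hsep h48
  obtain ⟨x, hx⟩ := hC η hη0 hη T hT hnorm hsep h48
  rcases hx with ⟨hinj, hTx, hcon⟩ | ⟨hinj, hTx, hcon⟩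
  · have hn : ∀ i, 1 - η ≤ ‖x i‖ ∧ ‖x i‖ ≤ 1 + η := fun i => hnorm _ (mem_of_eq_image hTx i)
    have hs : ∀ i j, i ≠ j → 1 - η ≤ dist (x i) (x j) := fun i j hij =>
      hsep _ (mem_of_eq_image hTx i) _ (mem_of_eq_image hTx j) (hinj.ne hij)
    obtain ⟨A, hA⟩ := hF η hη0 hη x hn hs hcon
    exact Or.inl (shellCloseTo_fcc_of_labelled x hinj hTx A hA)
  · have hn : ∀ i, 1 - η ≤ ‖x i‖ ∧ ‖x i‖ ≤ 1 + η := fun i => hnorm _ (mem_of_eq_image hTx i)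
    have hs : ∀ i j, i ≠ j → 1 - η ≤ dist (x i) (x j) := fun i j hij =>
      hsep _ (mem_of_eq_image hTx i) _ (mem_of_eq_image hTx j) (hinj.ne hij)
    obtain ⟨A, hA⟩ := hH η hη0 hη x hn hs hcon
    exact Or.inr (shellCloseTo_hcp_of_labelled x hinj hTx A hA)

end Summit.AtomisticToContinuum.Crystallization.Theorems

end
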